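import Literature.Geometry.Riemannian.GreatSphereFibrationCharts
import HarnessLib

/-!
# The inverse of Hähl's affine chart: spread coordinates of the base (Hähl 1987, 2.1/2.9)

Fourth file of the proof programme for the corrected form of
`Literature.Geometry.Riemannian.Hahl1987_greatSphereFibration_base_sphere` (H. Hähl, Results
Math. 12 (1987) 99–118, Prop. 4.7). The affine chart `baseChart p x₀ x J : ℝᵏ → M ∖ {∞}`,
`c ↦ 𝒫 (x + J c)` (`GreatSphereFibrationCharts.lean`) is a bijection onto the punctured base; here
we construct its inverse EXPLICITLY from the spread (Hähl 2.1: every fibre subspace `U ≠ U∞` is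
the graph of a linear map `λ_U` over a complement of `U∞`, and the chart coordinate of `U` is
`λ_U (e)`):

* `baseSpan p m` — the fibre subspace of a point `m` of the base (`= fibreSpan p y` for `p y = m`);
* `spreadCoord J x m : ℝᵏ` — the unique `c` with `x + J c ∈ V_m` (projection of `x` to `W = V_w` along
  `V_m`, read in the frame `J`; junk `0` at `m = ∞ = p w`), so that `baseChart (spreadCoord m) = m`
  and `spreadCoord (baseChart c) = c` (`baseChart_spreadCoord`, `spreadCoord_baseChart`, `spreadCoord_eq_iff`);
* **linearity in the base vector**: `x ↦ spreadCoord J x m` is linear (`spreadCoord_add`,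
  `spreadCoord_smul`) — Hähl's "`U` is a linear subspace, so the map `x ↦ x'` (`(x, x') ∈ U`) is a
  vector space endomorphism `Λ_U`" (2.1, (L0)–(L2));
* **smoothness**: `m ↦ spreadCoord J x m` is `C^∞` on `M ∖ {∞}` (`contMDiffAt_spreadCoord`), because
  near each point it agrees with the local inverse of the chart provided by the inverse function
  theorem (`isLocalDiffeomorphAt_baseChart`). With the injectivity and openness of the chart this
  says that `baseChart` is a diffeomorphism `ℝᵏ ≅ M ∖ {∞}` — Hähl 2.9.

Everything is proved; definitions `baseSpan`, `spreadCoordₗ`/`spreadCoord` are explicit. No named facts.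

## References

* [Hahl1987] H. Hähl, Results Math. 12 (1987) 99–118 — 2.1 ((L0)–(L2)), 2.9.
-/

noncomputable section

open Set Function Module Submodule Metric
open scoped Manifold ContDiff Topology

namespace Literature.Geometry.Riemannian

variable {E : Type*} [NormedAddCommGroup E] [InnerProductSpace ℝ E] {M : Type*}
  {k : ℕ} {p : sphere (0 : E) 1 → M} {x₀ : sphere (0 : E) 1}

/-! ### The fibre subspace of a base point -/

/-- The **fibre subspace of a base point** `m`: the span of the fibre `p ⁻¹' {m}` in `E`
(`= fibreSpan p y` for any `y` with `p y = m`, definitionally; `= ⊥` if `m` is not a value).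
[cite: Hahl1987, 2.1] -/
def baseSpan (p : sphere (0 : E) 1 → M) (m : M) : Submodule ℝ E :=
  span ℝ (Subtype.val '' (p ⁻¹' {m}))

/-- `V_{p y} = V_y`. [folklore] -/
@[simp]
theorem baseSpan_apply (y : sphere (0 : E) 1) : baseSpan p (p y) = fibreSpan p y := rfl

/-! ### The inverse chart -/

variable {w : sphere (0 : E) 1} (J : EuclideanSpace ℝ (Fin k) ≃L[ℝ] fibreSpan p w)

open Classical in
/-- The inverse chart as a linear map in the base vector `x`: for `m` with `V_m` complementary to
`W = V_w`, `x ↦ -J⁻¹ (π x)` where `π` is the projection of `E` onto `W` along `V_m` (so that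
`x + J (spreadCoordₗ x) = x - π x ∈ V_m`); the zero map otherwise (junk at `m = ∞`). Hähl 2.1: the
endomorphism `Λ_U` of which `U` is the graph, evaluated through the frame. [cite: Hahl1987, 2.1] -/
def spreadCoordₗ (J : EuclideanSpace ℝ (Fin k) ≃L[ℝ] fibreSpan p w) (m : M) :
    E →ₗ[ℝ] EuclideanSpace ℝ (Fin k) :=
  if h : IsCompl (fibreSpan p w) (baseSpan p m) then
    -((J.symm : fibreSpan p w →L[ℝ] EuclideanSpace ℝ (Fin k)).toLinearMap.comp
      ((fibreSpan p w).projectionOnto (baseSpan p m) h))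
  else 0

/-- **The inverse of the affine chart** `baseChart p x₀ x J`: `spreadCoord J x m` is the coordinate
`c` with `x + J c ∈ V_m` (junk `0` at `m = ∞ = p w`). Hähl 2.1/2.9: the chart coordinate `a` of the
fibre subspace `U = U_a` is determined by `(e, a) ∈ U`. [cite: Hahl1987, 2.1 and 2.9] -/
def spreadCoord (J : EuclideanSpace ℝ (Fin k) ≃L[ℝ] fibreSpan p w) (x : E) (m : M) :
    EuclideanSpace ℝ (Fin k) :=
  spreadCoordₗ J m x

/-- Unfolding. [folklore] -/
theorem spreadCoord_def (x : E) (m : M) : spreadCoord J x m = spreadCoordₗ J m x := rfl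

/-- **Linearity in the base vector**, additivity. [cite: Hahl1987, 2.1] -/
theorem spreadCoord_add (x x' : E) (m : M) : spreadCoord J (x + x') m = spreadCoord J x m + spreadCoord J x' m := by
  simp only [spreadCoord_def, map_add]

/-- **Linearity in the base vector**, homogeneity. [cite: Hahl1987, 2.1] -/
theorem spreadCoord_smul (s : ℝ) (x : E) (m : M) : spreadCoord J (s • x) m = s • spreadCoord J x m := by
  simp only [spreadCoord_def, map_smul]

/-- `spreadCoord J 0 m = 0`. [folklore] -/
@[simp]
theorem spreadCoord_zero_left (m : M) : spreadCoord J (0 : E) m = 0 := by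
  simp only [spreadCoord_def, map_zero]

/-- Linearity, finite sums. [cite: Hahl1987, 2.1] -/
theorem spreadCoord_sum {ι : Type*} (s : Finset ι) (f : ι → E) (m : M) :
    spreadCoord J (∑ i ∈ s, f i) m = ∑ i ∈ s, spreadCoord J (f i) m := by
  simp only [spreadCoord_def, map_sum]

/-- The defining property: when `V_m` is a complement of `W`, `x + J (spreadCoord J x m) ∈ V_m`.
[cite: Hahl1987, 2.1] -/
theorem add_frame_spreadCoord_mem {m : M} (h : IsCompl (fibreSpan p w) (baseSpan p m)) (x : E) :
    x + ((J (spreadCoord J x m) : fibreSpan p w) : E) ∈ baseSpan p m := by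
  rw [spreadCoord_def, spreadCoordₗ, dif_pos h]
  simp only [LinearMap.neg_apply, LinearMap.coe_comp, comp_apply, ContinuousLinearMap.coe_coe,
    ContinuousLinearEquiv.coe_coe, map_neg, ContinuousLinearEquiv.apply_symm_apply, Submodule.coe_neg,
    coe_projectionOnto_apply]
  rw [← sub_eq_add_neg]
  exact sub_projection_mem h x

/-- At a point whose fibre subspace is not complementary to `W` (i.e. at `∞`), the junk value `0`.
[folklore] -/
theorem spreadCoord_of_not_isCompl {m : M} (h : ¬ IsCompl (fibreSpan p w) (baseSpan p m)) (x : E) :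
    spreadCoord J x m = 0 := by
  rw [spreadCoord_def, spreadCoordₗ, dif_neg h, LinearMap.zero_apply]

/-- At `∞` the junk value: `spreadCoord J x (p w) = 0` (`W` is not its own complement, being
non-zero). [folklore] -/
theorem spreadCoord_apply_inf (x : E) : spreadCoord J x (p w) = 0 := by
  refine spreadCoord_of_not_isCompl J (fun h => ?_) x
  rw [baseSpan_apply] at h
  have hw : (w : E) ∈ fibreSpan p w := self_mem_fibreSpan w
  have h0 : (w : E) = 0 := by
    have := h.disjoint
    rw [disjoint_self] at this
    rw [this] at hw
    exact (Submodule.mem_bot ℝ).1 hw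
  exact ne_zero_of_mem_unit_sphere w h0

section WithHyp

variable {d : ℕ} [Fact (finrank ℝ E = d + 1)] [TopologicalSpace M]
  [ChartedSpace (EuclideanSpace ℝ (Fin k)) M] (hp : IsGreatSphereSubmersion d k p) {x : E}
include hp

/-- For `m ≠ ∞`, `V_m` is a complement of `W`. [cite: Hahl1987, 2.1] -/
theorem isCompl_baseSpan {m : M} (hm : m ≠ p w) : IsCompl (fibreSpan p w) (baseSpan p m) := by
  obtain ⟨y, rfl⟩ := hp.surjective m
  exact hp.isCompl (Ne.symm hm)

/-- **Characterisation**: for `m ≠ ∞`, `spreadCoord J x m = c ↔ x + J c ∈ V_m` (uniqueness because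
`V_m ∩ W = 0` and `J` is injective). [cite: Hahl1987, 2.1] -/
theorem spreadCoord_eq_iff {m : M} (hm : m ≠ p w) {c : EuclideanSpace ℝ (Fin k)} :
    spreadCoord J x m = c ↔ x + ((J c : fibreSpan p w) : E) ∈ baseSpan p m := by
  have hc := isCompl_baseSpan hp hm (w := w)
  constructor
  · rintro rfl
    exact add_frame_spreadCoord_mem J hc x
  · intro h
    have h' := add_frame_spreadCoord_mem J hc x
    have hdiff : ((J (spreadCoord J x m) : fibreSpan p w) : E) - (J c : E) ∈ baseSpan p m := by
      have := sub_mem h' h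
      rwa [add_sub_add_left_eq_sub] at this
    have hW : ((J (spreadCoord J x m) : fibreSpan p w) : E) - (J c : E) ∈ fibreSpan p w :=
      sub_mem (J _).2 (J c).2
    have h0 := Submodule.disjoint_def.1 hc.disjoint _ hW hdiff
    exact J.injective (Subtype.ext (sub_eq_zero.1 h0))

/-- `spreadCoord J x m = 0` iff `x ∈ V_m` (`m ≠ ∞`); e.g. the centre of the chart `baseChart p x₀ x J`
is the fibre of `x`. [cite: Hahl1987, 2.1] -/
theorem spreadCoord_eq_zero_iff {m : M} (hm : m ≠ p w) : spreadCoord J x m = 0 ↔ x ∈ baseSpan p m := by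
  rw [spreadCoord_eq_iff J hp hm, map_zero, ZeroMemClass.coe_zero, add_zero]

/-- **`spreadCoord` is a left inverse of the chart**: `spreadCoord J x (baseChart p x₀ x J c) = c` for
`x ∉ W`. [cite: Hahl1987, 2.9] -/
theorem spreadCoord_baseChart (hx : x ∉ fibreSpan p w) (c : EuclideanSpace ℝ (Fin k)) :
    spreadCoord J x (baseChart p x₀ x J c) = c := by
  rw [spreadCoord_eq_iff J hp (baseChart_ne J hp hx c), baseChart_apply, coneExtension, baseSpan_apply]
  exact mem_fibreSpan_unitVec (add_frame_ne_zero J hx c)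

/-- **`spreadCoord` is a right inverse of the chart** on `M ∖ {∞}`: `baseChart (spreadCoord J x m) = m`.
[cite: Hahl1987, 2.9] -/
theorem baseChart_spreadCoord (hx : x ∉ fibreSpan p w) {m : M} (hm : m ≠ p w) :
    baseChart p x₀ x J (spreadCoord J x m) = m := by
  obtain ⟨y, rfl⟩ := hp.surjective m
  have hmem : x + ((J (spreadCoord J x (p y)) : fibreSpan p w) : E) ∈ fibreSpan p y :=
    (spreadCoord_eq_iff J hp hm).1 rfl
  rw [baseChart_apply]
  exact coneExtension_eq_of_mem hp.exists_fibre (add_frame_ne_zero J hx _) hmem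

/-- `spreadCoord J x` is injective on `M ∖ {∞}` (`x ∉ W`). [folklore] -/
theorem spreadCoord_injOn (hx : x ∉ fibreSpan p w) : InjOn (spreadCoord J x) {p w}ᶜ := by
  intro m hm m' hm' h
  rw [← baseChart_spreadCoord J hp hx hm (x₀ := w), h, baseChart_spreadCoord J hp hx hm']

/-- Transition between two charts with the same coordinate space `W` but different base vectors:
if `baseChart p x₀ x J c = m` then `spreadCoord J x' m` is the `W`-coordinate of the point of `V_m`
over `x'` — in particular `spreadCoord J x m = c`. Recorded as: `spreadCoord J x' (baseChart p x₀ x J c)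
= c'` iff `x' + J c' ∈ V_{(x + J c)/‖…‖}`. [cite: Hahl1987, 2.1] -/
theorem spreadCoord_baseChart_eq_iff (hx : x ∉ fibreSpan p w) (x' : E) (c c' : EuclideanSpace ℝ (Fin k)) :
    spreadCoord J x' (baseChart p x₀ x J c) = c' ↔
      x' + ((J c' : fibreSpan p w) : E) ∈ fibreSpan p (unitVec x₀ (x + (J c : E))) := by
  rw [spreadCoord_eq_iff J hp (baseChart_ne J hp hx c), baseChart_apply, coneExtension, baseSpan_apply]

/-! ### Smoothness of the inverse chart -/

variable [IsManifold (𝓡 k) ∞ M]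

/-- **The inverse chart is smooth on `M ∖ {∞}`.** Near `m = baseChart c` it coincides with the
inverse of the local diffeomorphism given by the inverse function theorem
(`isLocalDiffeomorphAt_baseChart`), by injectivity of the chart. Hähl 2.9: `baseChart` is a
diffeomorphism `ℝᵏ ≅ M ∖ {∞}`. [cite: Hahl1987, 2.9] -/
theorem contMDiffAt_spreadCoord (hx : x ∉ fibreSpan p w) {m : M} (hm : m ≠ p w) :
    ContMDiffAt (𝓡 k) 𝓘(ℝ, EuclideanSpace ℝ (Fin k)) ∞ (spreadCoord J x) m := by
  set c := spreadCoord J x m with hc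
  obtain ⟨e, hce, heq⟩ := isLocalDiffeomorphAt_baseChart J hp hx c (x₀ := w)
  have hem : e c = m := by rw [← heq hce, hc, baseChart_spreadCoord J hp hx hm]
  have hmt : m ∈ e.target := by rw [← hem]; exact e.map_source hce
  -- near `m`, `spreadCoord J x = e.symm`
  have hEq : spreadCoord J x =ᶠ[𝓝 m] fun m' => e.invFun m' := by
    filter_upwards [e.open_target.mem_nhds hmt] with m' hm'
    have hs : e.invFun m' ∈ e.source := e.map_target hm'
    have h1 : baseChart p w x J (e.invFun m') = m' := by
      rw [heq hs]
      exact e.right_inv hm'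
    conv_lhs => rw [← h1]
    rw [spreadCoord_baseChart J hp hx]
  refine ContMDiffAt.congr_of_eventuallyEq ?_ hEq
  exact e.contMDiffOn_invFun.contMDiffAt (e.open_target.mem_nhds hmt)

/-- Continuity of the inverse chart on `M ∖ {∞}`. [cite: Hahl1987, 2.9] -/
theorem continuousAt_spreadCoord (hx : x ∉ fibreSpan p w) {m : M} (hm : m ≠ p w) :
    ContinuousAt (spreadCoord J x) m :=
  (contMDiffAt_spreadCoord J hp hx hm).continuousAt

/-- Smoothness of the inverse chart on the open set `M ∖ {∞}`. [cite: Hahl1987, 2.9] -/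
theorem contMDiffOn_spreadCoord (hx : x ∉ fibreSpan p w) :
    ContMDiffOn (𝓡 k) 𝓘(ℝ, EuclideanSpace ℝ (Fin k)) ∞ (spreadCoord J x) {p w}ᶜ := fun _ hm =>
  (contMDiffAt_spreadCoord J hp hx hm).contMDiffWithinAt

/-- **The coordinate change `𝒫`-then-`spreadCoord` is smooth**: `v ↦ spreadCoord J x (𝒫 v)` is `C^∞`
at every `v ∉ W` (there `𝒫 v ≠ ∞`). All transition maps of Hähl's §2 and §4 (`y/x`, `x\y`, `ψ̃`)
are instances. [cite: Hahl1987, 2.9] -/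
theorem contMDiffAt_spreadCoord_coneExtension (hx : x ∉ fibreSpan p w) {v : E}
    (hv : v ∉ fibreSpan p w) :
    ContMDiffAt 𝓘(ℝ, E) 𝓘(ℝ, EuclideanSpace ℝ (Fin k)) ∞
      (fun v => spreadCoord J x (coneExtension p x₀ v)) v := by
  have hv0 : v ≠ 0 := fun h => hv (h ▸ zero_mem _)
  have hne : coneExtension p x₀ v ≠ p w := by
    rw [← coneExtension_coe (p := p) (x₀ := x₀) w, Ne, coneExtension_eq_iff hp.exists_fibre _ hv0,
      unitVec_coe]
    exact hv
  exact (contMDiffAt_spreadCoord J hp hx hne).comp v (contMDiffAt_coneExtension hp.contMDiff hv0)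

/-- The same, as `ContDiffAt` between the vector spaces `E` and `ℝᵏ`. [cite: Hahl1987, 2.9] -/
theorem contDiffAt_spreadCoord_coneExtension (hx : x ∉ fibreSpan p w) {v : E}
    (hv : v ∉ fibreSpan p w) :
    ContDiffAt ℝ ∞ (fun v => spreadCoord J x (coneExtension p x₀ v)) v :=
  (contMDiffAt_spreadCoord_coneExtension J hp hx hv).contDiffAt

end WithHyp

end Literature.Geometry.Riemannian

end
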